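import Mathlib
import Summits.MatrixMultiplication.MatrixMultiplication.Theses.SemilatticeSTPP
import Summits.MatrixMultiplication.MatrixMultiplication.Theorems.Thesis.Negative.SemilatticeSTPPVolumeFloor

/-!
# Line `registered` of crux `SemilatticeSTPP.Thesis` (stmt-MatrixMultiplication-5969):
# the semilattice garbage toolkit — unmatched products sit strictly below no γ-fibre, linked and
# row/column-sharing garbage values are distinct, and a single block costs `1 + ac + 3·max(a,c)` cells

Hosts here are SEMILATTICES = commutative idempotent monoids (product = join, `1` = bottom), with the natural
order `v ≤ w :↔ v * w = w`.  For a monoid-TPP family (iff-form, verbatim the one of `Thesis`) and a block `i`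
write `x(s,t) := α ⟨i,(s,t)⟩`, `y(t,u) := β ⟨i,(t,u)⟩`, `z(s,u) := γ ⟨i,(s,u)⟩`.  The iff gives the MATCHED
products `x(s,t) * y(t,u) = z(s,u)` and says that an UNMATCHED product `g := x(s,t₁) * y(t₂,u)` (`t₁ ≠ t₂`,
"garbage") is never a γ-value; idempotency gives `x(s,t) ≤ z(s,u)`, `y(t,u) ≤ z(s,u)` and hence `g ≤ z(s,u)`.

* `garbage_not_ge_gamma_of_idempotent` — a garbage value `g = x(s,t₁) * y(t₂,u)` is above NO γ-value of its
  block: `z(s'',u'') ≤ g` would give `y(t₁,u'') ≤ g`, so `z(s,u'') = x(s,t₁) * y(t₁,u'') ≤ g`, so `x(s,t₂) ≤ g`,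
  so `z(s,u) = x(s,t₂) * y(t₂,u) ≤ g ≤ z(s,u)`, i.e. the unmatched product `g` equals `z(s,u)` — impossible.
* `garbage_ne_garbage_of_linked` — two garbage products with linked labels (`t₂ = t₃` or `t₁ = t₄`) are
  distinct: a common value `g` would absorb an `x` and a `y` with a common middle index, hence a whole
  γ-value, contradicting the previous lemma.
* `garbage_ne_garbage_of_same_row_or_col` — two garbage products of fibres sharing a row (`s = s'`, `u ≠ u'`)
  or a column (`s ≠ s'`, `u = u'`) are distinct: a common value forces `z(s,u) ≤ z(s',u')` and
  `z(s',u') ≤ z(s,u)`, so `z(s,u) = z(s',u')`, contradicting the injectivity of `γ` on the block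
  (`gamma_injective_of_tpp`).
* `card_ge_of_single_block_of_idempotent` — for one block `⟨a,b,c⟩` with `b ≥ 3`, `a, c ≥ 1` the bottom `1`,
  the `ac` values of `γ` and, for a fixed column `u₀` (resp. row `s₀`), the `3a` (resp. `3c`) cyclic garbage
  values `x(s,t_r) * y(t_{r+1},u₀)` (resp. `x(s₀,t_r) * y(t_{r+1},u)`), `r ∈ ℤ/3`, are pairwise distinct, so
  `1 + ac + 3a ≤ |M|` and `1 + ac + 3c ≤ |M|`.

Mathlib + the route file + `Negative/SemilatticeSTPPVolumeFloor` (`gamma_injective_of_tpp`) only; no cited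
facts; sorry-free.  The generic one-line order lemmas are `private` (they are not part of the toolkit API).
-/

set_option linter.dupNamespace false
-- (single-conjunct summit: the namespace repeats `MatrixMultiplication`)

namespace Summit.MatrixMultiplication.MatrixMultiplication.Theorems.SemilatticeSTPPThesis

open Summit.MatrixMultiplication.MatrixMultiplication.Theorems.Thesis.Negative.SemilatticeSTPPVolumeFloor
  (gamma_injective_of_tpp)

section Helpers

variable {M : Type} [CommMonoid M]

/-- Transitivity of the natural order `v ≤ w :↔ v * w = w` of a commutative monoid:
`v * x = v * (w * x) = (v * w) * x = w * x = x`. [folklore] -/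
private theorem sl_le_trans {v w x : M} (h₁ : v * w = w) (h₂ : w * x = x) : v * x = x := by
  rw [← h₂, ← mul_assoc, h₁]

/-- Joins are least upper bounds: `v ≤ x` and `w ≤ x` give `v * w ≤ x`. [folklore] -/
private theorem sl_mul_le {v w x : M} (h₁ : v * x = x) (h₂ : w * x = x) : v * w * x = x := by
  rw [mul_assoc, h₂, h₁]

/-- Antisymmetry of the natural order: `v ≤ w` and `w ≤ v` give `v = w * v = v * w = w`. [folklore] -/
private theorem sl_antisymm {v w : M} (h₁ : v * w = w) (h₂ : w * v = v) : v = w := by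
  rw [← h₂, mul_comm, h₁]

/-- In an idempotent monoid every factor is absorbed by the product: `v * (v * w) = v * w`. [folklore] -/
private theorem sl_absorb_left (hid : ∀ v : M, v * v = v) (v w : M) : v * (v * w) = v * w := by
  rw [← mul_assoc, hid]

/-- In a commutative idempotent monoid every factor is absorbed by the product: `w * (v * w) = v * w`.
[folklore] -/
private theorem sl_absorb_right (hid : ∀ v : M, v * v = v) (v w : M) : w * (v * w) = v * w := by
  rw [mul_left_comm, hid]

variable {p : ℕ} {a b c : Fin p → ℕ} {α : (Σ i, Fin (a i) × Fin (b i)) → M}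
  {β : (Σ i, Fin (b i) × Fin (c i)) → M} {γ : (Σ i, Fin (a i) × Fin (c i)) → M}

/-- MATCHED products: the TPP iff at `x = (s,t)`, `y = (t,u)`, `z = (s,u)` has a trivially true right-hand
side, so `x(s,t) * y(t,u) = z(s,u)`. -/
private theorem matched
    (htpp : ∀ x y z, α x * β y = γ z ↔
      (z.1 = x.1 ∧ x.1 = y.1 ∧ (z.2.1 : ℕ) = x.2.1 ∧ (x.2.2 : ℕ) = y.2.1 ∧ (z.2.2 : ℕ) = y.2.2))
    (i : Fin p) (s : Fin (a i)) (t : Fin (b i)) (u : Fin (c i)) :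
    α ⟨i, (s, t)⟩ * β ⟨i, (t, u)⟩ = γ ⟨i, (s, u)⟩ :=
  (htpp ⟨i, (s, t)⟩ ⟨i, (t, u)⟩ ⟨i, (s, u)⟩).2 ⟨rfl, rfl, rfl, rfl, rfl⟩

/-- UNMATCHED products ("garbage") are never γ-values: the fourth component of the TPP iff would read
`t₁ = t₂`. -/
private theorem unmatched
    (htpp : ∀ x y z, α x * β y = γ z ↔
      (z.1 = x.1 ∧ x.1 = y.1 ∧ (z.2.1 : ℕ) = x.2.1 ∧ (x.2.2 : ℕ) = y.2.1 ∧ (z.2.2 : ℕ) = y.2.2))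
    {i : Fin p} {s : Fin (a i)} {u : Fin (c i)} {t₁ t₂ : Fin (b i)} (ht : t₁ ≠ t₂)
    (z : Σ i, Fin (a i) × Fin (c i)) : α ⟨i, (s, t₁)⟩ * β ⟨i, (t₂, u)⟩ ≠ γ z :=
  fun H => ht (Fin.ext ((htpp _ _ _).1 H).2.2.2.1)

/-- `x(s,t) ≤ z(s,u)`: `x(s,t) * z(s,u) = x(s,t) * (x(s,t) * y(t,u)) = z(s,u)` by idempotency. -/
private theorem alpha_mul_gamma (hid : ∀ v : M, v * v = v)
    (htpp : ∀ x y z, α x * β y = γ z ↔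
      (z.1 = x.1 ∧ x.1 = y.1 ∧ (z.2.1 : ℕ) = x.2.1 ∧ (x.2.2 : ℕ) = y.2.1 ∧ (z.2.2 : ℕ) = y.2.2))
    (i : Fin p) (s : Fin (a i)) (t : Fin (b i)) (u : Fin (c i)) :
    α ⟨i, (s, t)⟩ * γ ⟨i, (s, u)⟩ = γ ⟨i, (s, u)⟩ := by
  rw [← matched htpp i s t u]
  exact sl_absorb_left hid _ _

/-- `y(t,u) ≤ z(s,u)`: `y(t,u) * z(s,u) = y(t,u) * (x(s,t) * y(t,u)) = z(s,u)` by idempotency and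
commutativity. -/
private theorem beta_mul_gamma (hid : ∀ v : M, v * v = v)
    (htpp : ∀ x y z, α x * β y = γ z ↔
      (z.1 = x.1 ∧ x.1 = y.1 ∧ (z.2.1 : ℕ) = x.2.1 ∧ (x.2.2 : ℕ) = y.2.1 ∧ (z.2.2 : ℕ) = y.2.2))
    (i : Fin p) (s : Fin (a i)) (t : Fin (b i)) (u : Fin (c i)) :
    β ⟨i, (t, u)⟩ * γ ⟨i, (s, u)⟩ = γ ⟨i, (s, u)⟩ := by
  rw [← matched htpp i s t u]
  exact sl_absorb_right hid _ _

/-- Garbage sits below the γ-value of its own fibre: `x(s,t₁) * y(t₂,u) ≤ z(s,u)`, as both factors do. -/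
private theorem garbage_mul_gamma (hid : ∀ v : M, v * v = v)
    (htpp : ∀ x y z, α x * β y = γ z ↔
      (z.1 = x.1 ∧ x.1 = y.1 ∧ (z.2.1 : ℕ) = x.2.1 ∧ (x.2.2 : ℕ) = y.2.1 ∧ (z.2.2 : ℕ) = y.2.2))
    (i : Fin p) (s : Fin (a i)) (u : Fin (c i)) (t₁ t₂ : Fin (b i)) :
    α ⟨i, (s, t₁)⟩ * β ⟨i, (t₂, u)⟩ * γ ⟨i, (s, u)⟩ = γ ⟨i, (s, u)⟩ :=
  sl_mul_le (alpha_mul_gamma hid htpp i s t₁ u) (beta_mul_gamma hid htpp i s t₂ u)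

end Helpers

/-- **Garbage is above no γ-fibre of its block (T4).**  In a commutative idempotent host of a monoid-TPP
family (iff-form), for `t₁ ≠ t₂` the unmatched product `g := α(s,t₁) * β(t₂,u)` never satisfies
`γ(s'',u'') * g = g` (i.e. `γ(s'',u'') ≤ g`): otherwise `β(t₁,u'') ≤ γ(s'',u'') ≤ g` and `α(s,t₁) ≤ g` give
`γ(s,u'') = α(s,t₁) * β(t₁,u'') ≤ g`, then `α(s,t₂) ≤ γ(s,u'') ≤ g` and `β(t₂,u) ≤ g` give
`γ(s,u) = α(s,t₂) * β(t₂,u) ≤ g`; with `g ≤ γ(s,u)` this makes the unmatched product `g` equal to `γ(s,u)`,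
and the TPP iff reads `t₁ = t₂`. [folklore] -/
theorem garbage_not_ge_gamma_of_idempotent :
    ∀ (M : Type) [CommMonoid M], (∀ v : M, v * v = v) →
      ∀ (p : ℕ) (a b c : Fin p → ℕ) (α : (Σ i, Fin (a i) × Fin (b i)) → M)
        (β : (Σ i, Fin (b i) × Fin (c i)) → M) (γ : (Σ i, Fin (a i) × Fin (c i)) → M),
        (∀ x y z, α x * β y = γ z ↔
          (z.1 = x.1 ∧ x.1 = y.1 ∧ (z.2.1 : ℕ) = x.2.1 ∧ (x.2.2 : ℕ) = y.2.1 ∧ (z.2.2 : ℕ) = y.2.2)) →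
        ∀ (i : Fin p) (s s'' : Fin (a i)) (u u'' : Fin (c i)) (t₁ t₂ : Fin (b i)), t₁ ≠ t₂ →
          γ ⟨i, (s'', u'')⟩ * (α ⟨i, (s, t₁)⟩ * β ⟨i, (t₂, u)⟩) ≠ α ⟨i, (s, t₁)⟩ * β ⟨i, (t₂, u)⟩ := by
  intro M _ hid p a b c α β γ htpp i s s'' u u'' t₁ t₂ ht H
  set g := α ⟨i, (s, t₁)⟩ * β ⟨i, (t₂, u)⟩
  -- the two factors of `g` lie below `g`
  have hx₁ : α ⟨i, (s, t₁)⟩ * g = g := sl_absorb_left hid _ _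
  have hy₂ : β ⟨i, (t₂, u)⟩ * g = g := sl_absorb_right hid _ _
  -- `β(t₁,u'') ≤ γ(s'',u'') ≤ g`, hence `γ(s,u'') = α(s,t₁) * β(t₁,u'') ≤ g`
  have hy₁ : β ⟨i, (t₁, u'')⟩ * g = g := sl_le_trans (beta_mul_gamma hid htpp i s'' t₁ u'') H
  have hz₁ : γ ⟨i, (s, u'')⟩ * g = g := by
    rw [← matched htpp i s t₁ u'']
    exact sl_mul_le hx₁ hy₁
  -- `α(s,t₂) ≤ γ(s,u'') ≤ g`, hence `γ(s,u) = α(s,t₂) * β(t₂,u) ≤ g`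
  have hx₂ : α ⟨i, (s, t₂)⟩ * g = g := sl_le_trans (alpha_mul_gamma hid htpp i s t₂ u'') hz₁
  have hz : γ ⟨i, (s, u)⟩ * g = g := by
    rw [← matched htpp i s t₂ u]
    exact sl_mul_le hx₂ hy₂
  -- but `g ≤ γ(s,u)`, so the unmatched product `g` equals `γ(s,u)`
  exact unmatched htpp ht ⟨i, (s, u)⟩ (sl_antisymm (garbage_mul_gamma hid htpp i s u t₁ t₂) hz)

/-- **Linked garbage is distinct (T5).**  In a commutative idempotent host of a monoid-TPP family (iff-form),
two unmatched products `α(s,t₁) * β(t₂,u)` (`t₁ ≠ t₂`) and `α(s',t₃) * β(t₄,u')` (`t₃ ≠ t₄`) of the same block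
whose labels are linked (`t₂ = t₃` or `t₁ = t₄`) are distinct: a common value `g` absorbs `α(s',t₃)` and
`β(t₂,u) = β(t₃,u)` (first case), hence `γ(s',u) ≤ g`, resp. `α(s,t₁)` and `β(t₄,u') = β(t₁,u')` (second
case), hence `γ(s,u') ≤ g` — both excluded by `garbage_not_ge_gamma_of_idempotent`. [folklore] -/
theorem garbage_ne_garbage_of_linked :
    ∀ (M : Type) [CommMonoid M], (∀ v : M, v * v = v) →
      ∀ (p : ℕ) (a b c : Fin p → ℕ) (α : (Σ i, Fin (a i) × Fin (b i)) → M)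
        (β : (Σ i, Fin (b i) × Fin (c i)) → M) (γ : (Σ i, Fin (a i) × Fin (c i)) → M),
        (∀ x y z, α x * β y = γ z ↔
          (z.1 = x.1 ∧ x.1 = y.1 ∧ (z.2.1 : ℕ) = x.2.1 ∧ (x.2.2 : ℕ) = y.2.1 ∧ (z.2.2 : ℕ) = y.2.2)) →
        ∀ (i : Fin p) (s s' : Fin (a i)) (u u' : Fin (c i)) (t₁ t₂ t₃ t₄ : Fin (b i)),
          t₁ ≠ t₂ → t₃ ≠ t₄ → (t₂ = t₃ ∨ t₁ = t₄) →
          α ⟨i, (s, t₁)⟩ * β ⟨i, (t₂, u)⟩ ≠ α ⟨i, (s', t₃)⟩ * β ⟨i, (t₄, u')⟩ := by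
  intro M _ hid p a b c α β γ htpp i s s' u u' t₁ t₂ t₃ t₄ h₁₂ h₃₄ hlink H
  rcases hlink with h₂₃ | h₁₄
  · -- `t₂ = t₃`: the second product absorbs `α(s',t₃)` and `β(t₂,u) = β(t₃,u)`, hence `γ(s',u)`
    have hm : α ⟨i, (s', t₃)⟩ * β ⟨i, (t₂, u)⟩ = γ ⟨i, (s', u)⟩ := by
      rw [h₂₃]
      exact matched htpp i s' t₃ u
    have hx : α ⟨i, (s', t₃)⟩ * (α ⟨i, (s', t₃)⟩ * β ⟨i, (t₄, u')⟩) = α ⟨i, (s', t₃)⟩ * β ⟨i, (t₄, u')⟩ :=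
      sl_absorb_left hid _ _
    have hy : β ⟨i, (t₂, u)⟩ * (α ⟨i, (s', t₃)⟩ * β ⟨i, (t₄, u')⟩) = α ⟨i, (s', t₃)⟩ * β ⟨i, (t₄, u')⟩ := by
      rw [← H]
      exact sl_absorb_right hid _ _
    refine garbage_not_ge_gamma_of_idempotent M hid p a b c α β γ htpp i s' s' u' u t₃ t₄ h₃₄ ?_
    rw [← hm]
    exact sl_mul_le hx hy
  · -- `t₁ = t₄`: the first product absorbs `α(s,t₁)` and `β(t₄,u') = β(t₁,u')`, hence `γ(s,u')`
    have hm : α ⟨i, (s, t₁)⟩ * β ⟨i, (t₄, u')⟩ = γ ⟨i, (s, u')⟩ := by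
      rw [h₁₄]
      exact matched htpp i s t₄ u'
    have hx : α ⟨i, (s, t₁)⟩ * (α ⟨i, (s, t₁)⟩ * β ⟨i, (t₂, u)⟩) = α ⟨i, (s, t₁)⟩ * β ⟨i, (t₂, u)⟩ :=
      sl_absorb_left hid _ _
    have hy : β ⟨i, (t₄, u')⟩ * (α ⟨i, (s, t₁)⟩ * β ⟨i, (t₂, u)⟩) = α ⟨i, (s, t₁)⟩ * β ⟨i, (t₂, u)⟩ := by
      rw [H]
      exact sl_absorb_right hid _ _
    refine garbage_not_ge_gamma_of_idempotent M hid p a b c α β γ htpp i s s u u' t₁ t₂ h₁₂ ?_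
    rw [← hm]
    exact sl_mul_le hx hy

/-- **Fibres sharing a row or a column share no garbage (T6).**  In a commutative idempotent host of a
monoid-TPP family (iff-form), unmatched products `g₁ := α(s,t₁) * β(t₂,u)` and `g₂ := α(s',t₃) * β(t₄,u')` of
the same block with `s = s', u ≠ u'` (row) or `s ≠ s', u = u'` (column) are distinct.  Row case: a common
value `g` gives `β(t₄,u') ≤ g ≤ γ(s,u)` and `α(s,t₄) ≤ γ(s,u)`, so `γ(s,u') = α(s,t₄) * β(t₄,u') ≤ γ(s,u)`,
and symmetrically `γ(s,u) ≤ γ(s,u')`; so `γ(s,u) = γ(s,u')` and the injectivity of `γ` on the block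
(`gamma_injective_of_tpp`) gives `u = u'`.  Column case: `α(s',t₃) ≤ g ≤ γ(s,u)` and `β(t₃,u) ≤ γ(s,u)` give
`γ(s',u) ≤ γ(s,u)`, symmetrically `γ(s,u) ≤ γ(s',u)`, whence `s = s'`. [folklore] -/
theorem garbage_ne_garbage_of_same_row_or_col :
    ∀ (M : Type) [CommMonoid M], (∀ v : M, v * v = v) →
      ∀ (p : ℕ) (a b c : Fin p → ℕ) (α : (Σ i, Fin (a i) × Fin (b i)) → M)
        (β : (Σ i, Fin (b i) × Fin (c i)) → M) (γ : (Σ i, Fin (a i) × Fin (c i)) → M),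
        (∀ x y z, α x * β y = γ z ↔
          (z.1 = x.1 ∧ x.1 = y.1 ∧ (z.2.1 : ℕ) = x.2.1 ∧ (x.2.2 : ℕ) = y.2.1 ∧ (z.2.2 : ℕ) = y.2.2)) →
        ∀ (i : Fin p) (s s' : Fin (a i)) (u u' : Fin (c i)) (t₁ t₂ t₃ t₄ : Fin (b i)),
          t₁ ≠ t₂ → t₃ ≠ t₄ → ((s = s' ∧ u ≠ u') ∨ (s ≠ s' ∧ u = u')) →
          α ⟨i, (s, t₁)⟩ * β ⟨i, (t₂, u)⟩ ≠ α ⟨i, (s', t₃)⟩ * β ⟨i, (t₄, u')⟩ := by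
  intro M _ hid p a b c α β γ htpp i s s' u u' t₁ t₂ t₃ t₄ _ _ hrc H
  have hb : 0 < b i := t₁.pos
  rcases hrc with ⟨hss, huu⟩ | ⟨hss, huu⟩
  · -- row case `s = s'`, `u ≠ u'`
    rw [← hss] at H
    have hg₁ := garbage_mul_gamma hid htpp i s u t₁ t₂
    have hg₂ := garbage_mul_gamma hid htpp i s u' t₃ t₄
    have hy₄ : β ⟨i, (t₄, u')⟩ * (α ⟨i, (s, t₁)⟩ * β ⟨i, (t₂, u)⟩) = α ⟨i, (s, t₁)⟩ * β ⟨i, (t₂, u)⟩ := by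
      rw [H]
      exact sl_absorb_right hid _ _
    have hy₂ : β ⟨i, (t₂, u)⟩ * (α ⟨i, (s, t₃)⟩ * β ⟨i, (t₄, u')⟩) = α ⟨i, (s, t₃)⟩ * β ⟨i, (t₄, u')⟩ := by
      rw [← H]
      exact sl_absorb_right hid _ _
    -- `γ(s,u') ≤ γ(s,u)` and `γ(s,u) ≤ γ(s,u')`
    have h₁ : γ ⟨i, (s, u')⟩ * γ ⟨i, (s, u)⟩ = γ ⟨i, (s, u)⟩ := by
      rw [← matched htpp i s t₄ u']
      exact sl_mul_le (alpha_mul_gamma hid htpp i s t₄ u) (sl_le_trans hy₄ hg₁)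
    have h₂ : γ ⟨i, (s, u)⟩ * γ ⟨i, (s, u')⟩ = γ ⟨i, (s, u')⟩ := by
      rw [← matched htpp i s t₂ u]
      exact sl_mul_le (alpha_mul_gamma hid htpp i s t₂ u') (sl_le_trans hy₂ hg₂)
    have key := gamma_injective_of_tpp α β γ htpp ⟨i, (s, u)⟩ ⟨i, (s, u')⟩ hb (sl_antisymm h₂ h₁)
    simp only [Sigma.mk.injEq, heq_eq_eq, Prod.mk.injEq, true_and] at key
    exact huu key
  · -- column case `s ≠ s'`, `u = u'`
    rw [← huu] at H
    have hg₁ := garbage_mul_gamma hid htpp i s u t₁ t₂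
    have hg₂ := garbage_mul_gamma hid htpp i s' u t₃ t₄
    have hx₃ : α ⟨i, (s', t₃)⟩ * (α ⟨i, (s, t₁)⟩ * β ⟨i, (t₂, u)⟩) = α ⟨i, (s, t₁)⟩ * β ⟨i, (t₂, u)⟩ := by
      rw [H]
      exact sl_absorb_left hid _ _
    have hx₁ : α ⟨i, (s, t₁)⟩ * (α ⟨i, (s', t₃)⟩ * β ⟨i, (t₄, u)⟩) = α ⟨i, (s', t₃)⟩ * β ⟨i, (t₄, u)⟩ := by
      rw [← H]
      exact sl_absorb_left hid _ _
    -- `γ(s',u) ≤ γ(s,u)` and `γ(s,u) ≤ γ(s',u)`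
    have h₁ : γ ⟨i, (s', u)⟩ * γ ⟨i, (s, u)⟩ = γ ⟨i, (s, u)⟩ := by
      rw [← matched htpp i s' t₃ u]
      exact sl_mul_le (sl_le_trans hx₃ hg₁) (beta_mul_gamma hid htpp i s t₃ u)
    have h₂ : γ ⟨i, (s, u)⟩ * γ ⟨i, (s', u)⟩ = γ ⟨i, (s', u)⟩ := by
      rw [← matched htpp i s t₁ u]
      exact sl_mul_le (sl_le_trans hx₁ hg₂) (beta_mul_gamma hid htpp i s' t₁ u)
    have key := gamma_injective_of_tpp α β γ htpp ⟨i, (s, u)⟩ ⟨i, (s', u)⟩ hb (sl_antisymm h₂ h₁)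
    simp only [Sigma.mk.injEq, heq_eq_eq, Prod.mk.injEq, true_and, and_true] at key
    exact hss key

section Counting

variable {M : Type} [CommMonoid M] {p : ℕ} {a b c : Fin p → ℕ} {α : (Σ i, Fin (a i) × Fin (b i)) → M}
  {β : (Σ i, Fin (b i) × Fin (c i)) → M} {γ : (Σ i, Fin (a i) × Fin (c i)) → M}

/-- If `α(s,t₁) = 1` (the bottom) while the block has a second middle index `t₂ ≠ t₁`, then
`γ(s,u) = α(s,t₁) * β(t₁,u) = β(t₁,u)` and the unmatched product `α(s,t₂) * β(t₁,u) = α(s,t₂) * γ(s,u)`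
equals `γ(s,u)` (as `α(s,t₂) ≤ γ(s,u)`) — impossible. -/
private theorem false_of_alpha_eq_one (hid : ∀ v : M, v * v = v)
    (htpp : ∀ x y z, α x * β y = γ z ↔
      (z.1 = x.1 ∧ x.1 = y.1 ∧ (z.2.1 : ℕ) = x.2.1 ∧ (x.2.2 : ℕ) = y.2.1 ∧ (z.2.2 : ℕ) = y.2.2))
    {i : Fin p} {s : Fin (a i)} (u : Fin (c i)) {t₁ t₂ : Fin (b i)} (ht : t₁ ≠ t₂)
    (hx : α ⟨i, (s, t₁)⟩ = 1) : False := by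
  have hz : γ ⟨i, (s, u)⟩ = β ⟨i, (t₁, u)⟩ := by
    rw [← matched htpp i s t₁ u, hx, one_mul]
  have key : α ⟨i, (s, t₂)⟩ * β ⟨i, (t₁, u)⟩ = γ ⟨i, (s, u)⟩ := by
    rw [← hz]
    exact alpha_mul_gamma hid htpp i s t₂ u
  exact unmatched htpp ht.symm _ key

/-- The bottom `1` is not a garbage value: `1 = α(s,t₁) * β(t₂,u) ≥ α(s,t₁)` forces `α(s,t₁) = 1`. -/
private theorem one_ne_garbage (hid : ∀ v : M, v * v = v)
    (htpp : ∀ x y z, α x * β y = γ z ↔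
      (z.1 = x.1 ∧ x.1 = y.1 ∧ (z.2.1 : ℕ) = x.2.1 ∧ (x.2.2 : ℕ) = y.2.1 ∧ (z.2.2 : ℕ) = y.2.2))
    {i : Fin p} (s : Fin (a i)) (u : Fin (c i)) {t₁ t₂ : Fin (b i)} (ht : t₁ ≠ t₂) :
    (1 : M) ≠ α ⟨i, (s, t₁)⟩ * β ⟨i, (t₂, u)⟩ := by
  intro H
  have h := sl_absorb_left hid (α ⟨i, (s, t₁)⟩) (β ⟨i, (t₂, u)⟩)
  rw [← H, mul_one] at h
  exact false_of_alpha_eq_one hid htpp u ht h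

/-- The bottom `1` is not a γ-value of a block with two middle indices `t₁ ≠ t₂`:
`1 = γ(s,u) ≥ α(s,t₁)` forces `α(s,t₁) = 1`. -/
private theorem one_ne_gamma (hid : ∀ v : M, v * v = v)
    (htpp : ∀ x y z, α x * β y = γ z ↔
      (z.1 = x.1 ∧ x.1 = y.1 ∧ (z.2.1 : ℕ) = x.2.1 ∧ (x.2.2 : ℕ) = y.2.1 ∧ (z.2.2 : ℕ) = y.2.2))
    {i : Fin p} (s : Fin (a i)) (u : Fin (c i)) {t₁ t₂ : Fin (b i)} (ht : t₁ ≠ t₂) :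
    (1 : M) ≠ γ ⟨i, (s, u)⟩ := by
  intro H
  have h := alpha_mul_gamma hid htpp i s t₁ u
  rw [← H, mul_one] at h
  exact false_of_alpha_eq_one hid htpp u ht h

/-- γ-values are not garbage values (the TPP iff, read as in `unmatched`). -/
private theorem gamma_ne_garbage
    (htpp : ∀ x y z, α x * β y = γ z ↔
      (z.1 = x.1 ∧ x.1 = y.1 ∧ (z.2.1 : ℕ) = x.2.1 ∧ (x.2.2 : ℕ) = y.2.1 ∧ (z.2.2 : ℕ) = y.2.2))
    {i : Fin p} (z : Σ i, Fin (a i) × Fin (c i)) (s : Fin (a i)) (u : Fin (c i)) {t₁ t₂ : Fin (b i)}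
    (ht : t₁ ≠ t₂) : γ z ≠ α ⟨i, (s, t₁)⟩ * β ⟨i, (t₂, u)⟩ :=
  fun H => unmatched htpp ht z H.symm

/-- The counting core: in a finite commutative idempotent host of a monoid-TPP family, for a block `i` with
two middle indices `t₁ ≠ t₂` and any injective family `g : G → M` avoiding `1` and the γ-values of the
block, the bottom `1`, the `a i * c i` (distinct, `gamma_injective_of_tpp`) γ-values of the block and the
values of `g` are pairwise distinct, so `1 + a i * c i + |G| ≤ |M|`. -/
private theorem card_core [Fintype M] (hid : ∀ v : M, v * v = v)
    (htpp : ∀ x y z, α x * β y = γ z ↔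
      (z.1 = x.1 ∧ x.1 = y.1 ∧ (z.2.1 : ℕ) = x.2.1 ∧ (x.2.2 : ℕ) = y.2.1 ∧ (z.2.2 : ℕ) = y.2.2))
    (i : Fin p) {t₁ t₂ : Fin (b i)} (ht : t₁ ≠ t₂) {G : Type} [Fintype G] (g : G → M)
    (hg : Function.Injective g) (h1 : ∀ k, (1 : M) ≠ g k)
    (hγ : ∀ (su : Fin (a i) × Fin (c i)) (k : G), γ ⟨i, su⟩ ≠ g k) :
    1 + a i * c i + Fintype.card G ≤ Fintype.card M := by
  let φ : (Unit ⊕ (Fin (a i) × Fin (c i))) ⊕ G → M :=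
    Sum.elim (Sum.elim (fun _ => 1) fun su => γ ⟨i, su⟩) g
  have hφ : Function.Injective φ := by
    refine Function.Injective.sumElim (Function.Injective.sumElim ?_ ?_ ?_) hg ?_
    · exact fun _ _ _ => Subsingleton.elim _ _
    · intro su su' he
      exact eq_of_heq (Sigma.mk.inj_iff.mp
        (gamma_injective_of_tpp α β γ htpp ⟨i, su⟩ ⟨i, su'⟩ t₁.pos he)).2
    · exact fun _ su => one_ne_gamma hid htpp su.1 su.2 ht
    · rintro (_ | su) k
      exacts [h1 k, hγ su k]
  calc 1 + a i * c i + Fintype.card G = Fintype.card ((Unit ⊕ (Fin (a i) × Fin (c i))) ⊕ G) := by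
        simp only [Fintype.card_sum, Fintype.card_unit, Fintype.card_prod, Fintype.card_fin]
    _ ≤ Fintype.card M := Fintype.card_le_of_injective φ hφ

end Counting

/-- **Single-block count (T8).**  In a finite commutative idempotent host of a one-block monoid-TPP family
`⟨a,b,c⟩` with `b ≥ 3`, `a ≥ 1`, `c ≥ 1`, both `1 + ac + 3a ≤ |M|` and `1 + ac + 3c ≤ |M|`.  With
`t_r := r` (`r ∈ ℤ/3`, three distinct middle indices) and a fixed column `u₀`, the `3a` cyclic garbage values
`g(r,s) := α(s,t_r) * β(t_{r+1},u₀)` are pairwise distinct (same `s`: the labels are linked,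
`garbage_ne_garbage_of_linked`; different `s`: same column, `garbage_ne_garbage_of_same_row_or_col`), differ
from `1` and from every γ-value, and the `ac` γ-values are distinct and differ from `1` (`card_core`); the
second bound is the transpose (fixed row `s₀`, garbage `α(s₀,t_r) * β(t_{r+1},u)`). [folklore] -/
theorem card_ge_of_single_block_of_idempotent :
    ∀ (M : Type) [CommMonoid M] [Fintype M], (∀ v : M, v * v = v) →
      ∀ (a b c : Fin 1 → ℕ) (α : (Σ i, Fin (a i) × Fin (b i)) → M)
        (β : (Σ i, Fin (b i) × Fin (c i)) → M) (γ : (Σ i, Fin (a i) × Fin (c i)) → M),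
        (∀ x y z, α x * β y = γ z ↔
          (z.1 = x.1 ∧ x.1 = y.1 ∧ (z.2.1 : ℕ) = x.2.1 ∧ (x.2.2 : ℕ) = y.2.1 ∧ (z.2.2 : ℕ) = y.2.2)) →
        3 ≤ b 0 → 0 < a 0 → 0 < c 0 →
          1 + a 0 * c 0 + 3 * a 0 ≤ Fintype.card M ∧ 1 + a 0 * c 0 + 3 * c 0 ≤ Fintype.card M := by
  intro M _ _ hid a b c α β γ htpp hb ha hc
  -- three distinct middle indices `Fin.castLE hb r`, `r : Fin 3`, used cyclically
  have hsucc : ∀ r : Fin 3, r ≠ r + 1 := by decide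
  have hrot : ∀ r r' : Fin 3, r ≠ r' → r + 1 = r' ∨ r = r' + 1 := by decide
  have ht : ∀ r : Fin 3, Fin.castLE hb r ≠ Fin.castLE hb (r + 1) := fun r h =>
    hsucc r (Fin.castLE_injective hb h)
  refine ⟨?_, ?_⟩
  · -- cyclic garbage in the column of `u₀`
    let u₀ : Fin (c 0) := ⟨0, hc⟩
    let g : Fin 3 × Fin (a 0) → M := fun rs =>
      α ⟨0, (rs.2, Fin.castLE hb rs.1)⟩ * β ⟨0, (Fin.castLE hb (rs.1 + 1), u₀)⟩
    have hg : Function.Injective g := by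
      rintro ⟨r, s⟩ ⟨r', s'⟩ he
      by_contra hne
      by_cases hss : s = s'
      · have hrr : r ≠ r' := fun h => hne (Prod.ext h hss)
        rcases hrot r r' hrr with h | h
        · exact garbage_ne_garbage_of_linked M hid 1 a b c α β γ htpp 0 s s' u₀ u₀ _ _ _ _ (ht r) (ht r')
            (Or.inl (congrArg (Fin.castLE hb) h)) he
        · exact garbage_ne_garbage_of_linked M hid 1 a b c α β γ htpp 0 s s' u₀ u₀ _ _ _ _ (ht r) (ht r')
            (Or.inr (congrArg (Fin.castLE hb) h)) he
      · exact garbage_ne_garbage_of_same_row_or_col M hid 1 a b c α β γ htpp 0 s s' u₀ u₀ _ _ _ _ (ht r)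
          (ht r') (Or.inr ⟨hss, rfl⟩) he
    have key := card_core hid htpp 0 (ht 0) g hg (fun k => one_ne_garbage hid htpp k.2 u₀ (ht k.1))
      fun su k => gamma_ne_garbage htpp ⟨0, su⟩ k.2 u₀ (ht k.1)
    simpa only [Fintype.card_prod, Fintype.card_fin] using key
  · -- cyclic garbage in the row of `s₀`
    let s₀ : Fin (a 0) := ⟨0, ha⟩
    let g : Fin 3 × Fin (c 0) → M := fun ru =>
      α ⟨0, (s₀, Fin.castLE hb ru.1)⟩ * β ⟨0, (Fin.castLE hb (ru.1 + 1), ru.2)⟩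
    have hg : Function.Injective g := by
      rintro ⟨r, u⟩ ⟨r', u'⟩ he
      by_contra hne
      by_cases huu : u = u'
      · have hrr : r ≠ r' := fun h => hne (Prod.ext h huu)
        rcases hrot r r' hrr with h | h
        · exact garbage_ne_garbage_of_linked M hid 1 a b c α β γ htpp 0 s₀ s₀ u u' _ _ _ _ (ht r) (ht r')
            (Or.inl (congrArg (Fin.castLE hb) h)) he
        · exact garbage_ne_garbage_of_linked M hid 1 a b c α β γ htpp 0 s₀ s₀ u u' _ _ _ _ (ht r) (ht r')
            (Or.inr (congrArg (Fin.castLE hb) h)) he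
      · exact garbage_ne_garbage_of_same_row_or_col M hid 1 a b c α β γ htpp 0 s₀ s₀ u u' _ _ _ _ (ht r)
          (ht r') (Or.inl ⟨rfl, huu⟩) he
    have key := card_core hid htpp 0 (ht 0) g hg (fun k => one_ne_garbage hid htpp s₀ k.2 (ht k.1))
      fun su k => gamma_ne_garbage htpp ⟨0, su⟩ s₀ k.2 (ht k.1)
    simpa only [Fintype.card_prod, Fintype.card_fin] using key

end Summit.MatrixMultiplication.MatrixMultiplication.Theorems.SemilatticeSTPPThesis
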